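import Mathlib
import HarnessLib
import Summits.Ventures.LatticeQCDFlow.Scoring.BatchMeansConsistencyRate

/-!
# STRONG (almost-sure) CONSISTENCY OF THE BATCH-MEANS ESTIMATOR along any schedule with
# `Σ 1/a_n < ∞` and `Σ 1/b_n² < ∞`, from any start, under a geometric envelope / a Doeblin power

HONEST FRAMING: exact (Metropolis-corrected) sampling algorithms for lattice gauge theory;
figures of merit are autocorrelation/cost numbers at stated couplings and volumes; no
continuum-physics claim.

Venture `LatticeQCDFlow` (cell pub-lqcd), topic `Scoring`; FANOUT row 8 (`s0-cpn-nemc`, GEN-20).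
NEW WORK of the cell, not a published result; no definition is introduced; nothing is cited as a
fact.  `Scoring/BatchMeansConsistencyRate.lean` bounds the mean-square error of the batch-means
estimator `σ̂²_{a,b} = ab · SE²_BM` of the Green–Kubo variance by `K/a + K''/b²` from EVERY initial
law.  By Chebyshev and the first Borel–Cantelli lemma (Mathlib's `ae_eventually_notMem`), along any
schedule `(a_n, b_n)` with `a_n ≥ 2`, `b_n ≥ 1`, `Σ_n 1/a_n < ∞` and `Σ_n 1/b_n² < ∞` (e.g.
`a_n = n² + 2`, `b_n = n + 1`, run length `N_n ∼ n³`) the estimator converges to `σ²_f` ALMOST SURELY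
under `P_{μ₀}` — the strong consistency asked for in HANDOFF-GEN19 (5)(e), for every kernel with a
geometric sup-norm envelope, in particular every Doeblin power `(nHit κ m)(x, ·) ≥ ε ν`.  Printed
counterpart NAMED ONLY: strong consistency of batch means (Damerdji 1994, Math. Oper. Res. 19).

## Content

* `ae_eventually_lt_of_mse_summable` — Chebyshev + Borel–Cantelli bookkeeping: if `E[D_n²] ≤ c_n`
  with `Σ c_n < ∞` then for every `δ > 0`, a.e. `x`, eventually `D_n(x)² < δ²`;
* **`chain_batchMeans_sigmaHat_ae_tendsto_of_envelope`** — `σ̂²_{a_n,b_n} → σ²_f` `P_{μ₀}`-a.s.;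
* **`chain_batchMeans_sigmaHat_ae_tendsto_of_nHit`** — the same under a Doeblin power.

NOT CLAIMED: the schedule-free strong law (`a_n b_n = n` with no summability); rates of a.s.
convergence; unbounded observables.
-/

noncomputable section

namespace Summit.Ventures.LatticeQCDFlow.Scoring

open MeasureTheory ProbabilityTheory Filter Finset Preorder Literature.Probability.MarkovChains
open scoped ENNReal Topology

/-! ### Chebyshev + Borel–Cantelli -/

section BorelCantelli

variable {α : Type*} [MeasurableSpace α] {μ : Measure α} [IsProbabilityMeasure μ]

/-- **Chebyshev + first Borel–Cantelli**: if `D_n²` are integrable with `E[D_n²] ≤ c_n`,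
`Σ c_n < ∞`, then for every `δ > 0`, for `μ`-a.e. `x`, eventually `D_n(x)² < δ²`. -/
theorem ae_eventually_lt_of_mse_summable {D : ℕ → α → ℝ}
    (hiD : ∀ n, Integrable (fun x => D n x ^ 2) μ) {c : ℕ → ℝ} (hc : ∀ n, ∫ x, D n x ^ 2 ∂μ ≤ c n)
    (hsum : Summable c) {δ : ℝ} (hδ : 0 < δ) :
    ∀ᵐ x ∂μ, ∀ᶠ n in atTop, D n x ^ 2 < δ ^ 2 := by
  have hδ2 : 0 < δ ^ 2 := by positivity
  have hc0 : ∀ n, 0 ≤ c n := fun n => (integral_nonneg fun x => sq_nonneg (D n x)).trans (hc n)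
  -- Chebyshev: `μ {δ² ≤ D_n²} ≤ c_n / δ²`
  have hcheb : ∀ n, μ.real {x | δ ^ 2 ≤ D n x ^ 2} ≤ c n / δ ^ 2 := by
    intro n
    have h := mul_meas_ge_le_integral_of_nonneg (μ := μ) (ae_of_all _ fun x => sq_nonneg (D n x))
      (hiD n) (δ ^ 2)
    rw [le_div_iff₀ hδ2, mul_comm]
    exact h.trans (hc n)
  -- Borel–Cantelli in real form
  have h1 : ∀ n, μ {x | δ ^ 2 ≤ D n x ^ 2} ≤ ENNReal.ofReal (c n / δ ^ 2) := fun n =>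
    (ENNReal.le_ofReal_iff_toReal_le (measure_ne_top μ _) (div_nonneg (hc0 n) hδ2.le)).2 (hcheb n)
  have h2 : ∑' n, μ {x | δ ^ 2 ≤ D n x ^ 2} ≤ ∑' n, ENNReal.ofReal (c n / δ ^ 2) :=
    ENNReal.tsum_le_tsum h1
  have h3 : ∑' n, ENNReal.ofReal (c n / δ ^ 2) = ENNReal.ofReal (∑' n, c n / δ ^ 2) :=
    (ENNReal.ofReal_tsum_of_nonneg (fun n => div_nonneg (hc0 n) hδ2.le) (hsum.div_const _)).symm
  have hfin : ∑' n, μ {x | δ ^ 2 ≤ D n x ^ 2} ≠ ∞ :=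
    ne_top_of_le_ne_top (by rw [h3]; exact ENNReal.ofReal_ne_top) h2
  filter_upwards [ae_eventually_notMem hfin] with x hx
  filter_upwards [hx] with n hn
  simpa only [Set.mem_setOf_eq, not_le] using hn

end BorelCantelli

/-! ### Strong consistency of the batch-means estimator -/

section Envelope

variable {Ω : Type*} [MeasurableSpace Ω]
  {κ : Kernel Ω Ω} [IsMarkovKernel κ] {π : Measure Ω} [IsProbabilityMeasure π] {A ρ : ℝ}

/-- **STRONG CONSISTENCY OF THE BATCH-MEANS ESTIMATOR UNDER A SUP-NORM ENVELOPE, FROM ANY START.**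
`π` invariant, envelope `(A, ρ)` (`0 ≤ A`, `0 ≤ ρ < 1`), `|f| ≤ C` measurable; schedule `a_n ≥ 2`,
`b_n ≥ 1` with `Σ 1/a_n < ∞`, `Σ 1/b_n² < ∞`.  Then `a_n b_n · SE²_BM → σ²_f` almost surely under
`P_{μ₀}`, for EVERY initial law `μ₀`. -/
theorem chain_batchMeans_sigmaHat_ae_tendsto_of_envelope (hπ : Kernel.Invariant κ π)
    (henv : ∀ (g : Ω → ℝ), Measurable g → ∀ (Cg : ℝ), (∀ x, |g x| ≤ Cg) →
      ∀ (t : ℕ) (x : Ω), |(kop κ)^[t] g x - ∫ y, g y ∂π| ≤ 2 * Cg * (A * ρ ^ t))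
    (hA : 0 ≤ A) (hρ0 : 0 ≤ ρ) (hρ1 : ρ < 1)
    {f : Ω → ℝ} (hf : Measurable f) {C : ℝ} (hC : ∀ x, |f x| ≤ C)
    (μ₀ : Measure Ω) [IsProbabilityMeasure μ₀] {a b : ℕ → ℕ} (ha2 : ∀ n, 2 ≤ a n)
    (hb0 : ∀ n, b n ≠ 0) (hsa : Summable fun n => (1 : ℝ) / (a n : ℝ))
    (hsb : Summable fun n => (1 : ℝ) / ((b n : ℝ) ^ 2)) :
    ∀ᵐ x ∂(Kernel.trajMeasure (X := fun _ : ℕ => Ω) μ₀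
        (fun n : ℕ => κ.comap (fun h : (i : ↥(Finset.Iic n)) → Ω => h ⟨n, Finset.mem_Iic.2 le_rfl⟩)
          (measurable_pi_apply _))),
      Tendsto (fun n : ℕ => ((b n * a n : ℕ) : ℝ)
        * replicaSEsq (fun j (x : ℕ → Ω) => (∑ i ∈ Finset.range (b n), f (x (b n * j + i))) / (b n))
          (a n) x) atTop
        (𝓝 ((∫ y, (f y - ∫ z, f z ∂π) ^ 2 ∂π)
          + 2 * ∑' k, ∫ y, (f y - ∫ z, f z ∂π)
            * (kop κ)^[k + 1] (fun y => f y - ∫ z, f z ∂π) y ∂π)) := by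
  set P := Kernel.trajMeasure (X := fun _ : ℕ => Ω) μ₀
      (fun n : ℕ => κ.comap (fun h : (i : ↥(Finset.Iic n)) → Ω => h ⟨n, Finset.mem_Iic.2 le_rfl⟩)
        (measurable_pi_apply _)) with hP
  set c := ∫ z, f z ∂π with hc
  set σ2 := (∫ y, (f y - c) ^ 2 ∂π)
      + 2 * ∑' k, ∫ y, (f y - c) * (kop κ)^[k + 1] (fun y => f y - c) y ∂π with hσ2
  obtain ⟨K, K'', hKK⟩ := chain_batchMeans_sigmaHat_mse_le_rate_of_envelope hπ henv hA hρ0 hρ1 hf hC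
  -- the centred statistic `D n`
  set D : ℕ → (ℕ → Ω) → ℝ := fun n x => ((b n * a n : ℕ) : ℝ)
      * replicaSEsq (fun j (x : ℕ → Ω) => (∑ i ∈ Finset.range (b n), f (x (b n * j + i))) / (b n))
        (a n) x - σ2 with hD
  have hDm : ∀ n, Measurable (D n) := fun n =>
    (measurable_batchMeans_sigmaHat hf (a n) (b n)).sub measurable_const
  have hiD2 : ∀ n, Integrable (fun x => D n x ^ 2) P := fun n =>
    integrable_of_bounded P ((hDm n).pow_const 2) (C := (4 * (b n) * C ^ 2 + |σ2|) ^ 2) fun x => by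
      rw [abs_pow]
      refine pow_le_pow_left₀ (abs_nonneg _) ((abs_sub _ _).trans (add_le_add ?_ le_rfl)) 2
      exact abs_batchMeans_sigmaHat_le hC (ha2 n) (hb0 n) x
  have hmse : ∀ n, ∫ x, D n x ^ 2 ∂P ≤ K / (a n : ℝ) + K'' / ((b n : ℝ) ^ 2) := fun n => by
    have h := hKK μ₀ (a n) (b n) (ha2 n) (hb0 n)
    rw [← hP] at h
    exact h
  have hsum : Summable fun n => K / (a n : ℝ) + K'' / ((b n : ℝ) ^ 2) := by
    have h1 : Summable fun n => K / (a n : ℝ) := (hsa.mul_left K).congr fun n => by ring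
    have h2 : Summable fun n => K'' / ((b n : ℝ) ^ 2) := (hsb.mul_left K'').congr fun n => by ring
    exact h1.add h2
  -- a.e., for every `k`, eventually `D_n² < (1/(k+1))²`
  have hae : ∀ᵐ x ∂P, ∀ k : ℕ, ∀ᶠ n in atTop, D n x ^ 2 < (1 / ((k : ℝ) + 1)) ^ 2 := by
    rw [ae_all_iff]
    intro k
    exact ae_eventually_lt_of_mse_summable (μ := P) hiD2 hmse hsum (by positivity)
  filter_upwards [hae] with x hx
  -- `D n x → 0`, hence the statistic tends to `σ²`
  have hD0 : Tendsto (fun n => D n x) atTop (𝓝 0) := by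
    rw [Metric.tendsto_atTop]
    intro ε hε
    obtain ⟨k, hk⟩ := exists_nat_one_div_lt hε
    obtain ⟨N₀, hN₀⟩ := (hx k).exists_forall_of_atTop
    refine ⟨N₀, fun n hn => ?_⟩
    have h := hN₀ n hn
    rw [Real.dist_eq, sub_zero]
    have habs : |D n x| < 1 / ((k : ℝ) + 1) := by
      have := Real.sqrt_lt_sqrt (sq_nonneg _) h
      rwa [Real.sqrt_sq_eq_abs, Real.sqrt_sq (by positivity)] at this
    exact habs.trans hk
  have hfin := hD0.add_const σ2
  rw [zero_add] at hfin
  refine hfin.congr fun n => ?_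
  simp only [hD, sub_add_cancel]

end Envelope

section Power

variable {Ω : Type*} [MeasurableSpace Ω]
  {κ : Kernel Ω Ω} [IsMarkovKernel κ] {ν : Measure Ω} [IsProbabilityMeasure ν] {ε : ℝ≥0∞}
  {π : Measure Ω} [IsProbabilityMeasure π] {m : ℕ}

/-- **STRONG CONSISTENCY OF THE BATCH-MEANS ESTIMATOR UNDER A DOEBLIN POWER, FROM ANY START.**
`π` invariant, `(nHit κ m)(x, ·) ≥ ε ν` (`0 < ε ≤ 1`, `0 < m`), `|f| ≤ C` measurable; schedule
`a_n ≥ 2`, `b_n ≥ 1`, `Σ 1/a_n < ∞`, `Σ 1/b_n² < ∞`: `a_n b_n · SE²_BM → σ²_f` `P_{μ₀}`-a.s. -/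
theorem chain_batchMeans_sigmaHat_ae_tendsto_of_nHit (hπ : Kernel.Invariant κ π)
    (hmin : ∀ x {B : Set Ω}, MeasurableSet B → ε * ν B ≤ Exactness.nHit κ m x B) (hε0 : 0 < ε)
    (hε1 : ε ≤ 1) (hm : 0 < m) {f : Ω → ℝ} (hf : Measurable f) {C : ℝ} (hC : ∀ x, |f x| ≤ C)
    (μ₀ : Measure Ω) [IsProbabilityMeasure μ₀] {a b : ℕ → ℕ} (ha2 : ∀ n, 2 ≤ a n)
    (hb0 : ∀ n, b n ≠ 0) (hsa : Summable fun n => (1 : ℝ) / (a n : ℝ))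
    (hsb : Summable fun n => (1 : ℝ) / ((b n : ℝ) ^ 2)) :
    ∀ᵐ x ∂(Kernel.trajMeasure (X := fun _ : ℕ => Ω) μ₀
        (fun n : ℕ => κ.comap (fun h : (i : ↥(Finset.Iic n)) → Ω => h ⟨n, Finset.mem_Iic.2 le_rfl⟩)
          (measurable_pi_apply _))),
      Tendsto (fun n : ℕ => ((b n * a n : ℕ) : ℝ)
        * replicaSEsq (fun j (x : ℕ → Ω) => (∑ i ∈ Finset.range (b n), f (x (b n * j + i))) / (b n))
          (a n) x) atTop
        (𝓝 ((∫ y, (f y - ∫ z, f z ∂π) ^ 2 ∂π)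
          + 2 * ∑' k, ∫ y, (f y - ∫ z, f z ∂π)
            * (kop κ)^[k + 1] (fun y => f y - ∫ z, f z ∂π) y ∂π)) := by
  obtain ⟨A, ρ, hA, hρ0, hρ1, henv⟩ := exists_geometricEnvelope_of_nHit hmin hε0 hε1 hm hπ
  exact chain_batchMeans_sigmaHat_ae_tendsto_of_envelope hπ henv hA hρ0 hρ1 hf hC μ₀ ha2 hb0 hsa hsb

end Power

end Summit.Ventures.LatticeQCDFlow.Scoring

end
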